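/- Fleet lead `ym-wcr-19456-p1` (seat g2), route `WeakCouplingRates`, crux `ColdBoxTwoPointFloorW` (stmt-QuantumFields-19608). -/
-- tree-module: Summits.QuantumFields.YangMills.Theorems.WeakCouplingRatesColdBoxGaussRef
import Summits.QuantumFields.YangMills.Theorems.WeakCouplingRatesColdBoxOneScaleDefs
import Mathlib.MeasureTheory.Measure.Haar.Unique

/-!
# Crux `ColdBoxTwoPointFloorW`, stub `stub_boxGaussianDomination`, brick R4 (Gaussian side): the scaling is a constant-Jacobian change of
# variables, the chart weight IS the Dirichlet Gaussian weight times the tilt, and Gaussian-weighted integrals are `Z³·` expectations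

Three identities of the assembly of the one-scale expansion (objects in `…ColdBoxOneScaleDefs`):
* `exists_lintegral_eq_mul_lintegral_unscaleT` — **change of variables** `w = unscaleT β H t`: for `β > 0` there is a constant
  `a ∈ (0,∞)` with `∫⁻ F(w) dw = a · ∫⁻ F(unscaleT β H t) dt` for every measurable `F ≥ 0` (the image of Lebesgue measure under the linear
  equivalence `scaleEquiv` is a Haar measure, hence a multiple of Lebesgue measure: `isAddLeftInvariant_eq_smul`; the value of `a` is
  irrelevant — it cancels in normalised expectations);
* `boltzmann_mul_gnomonicDensity_eq` — **the density identity**, pointwise in `t`: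
  `e^{−β S_Λ(cfgT t)} · Π_e (2π²)⁻¹(1+|w_e|²)⁻² = (2π²)^{−n} · Π_i gaussWeight_{Q_D}(t i) · e^{tiltW β t}` — the definition of the tilt read
  backwards, with `Σ_i ½ M_D(t i) = Σ_{p touching Λ} qObs p t` (`formM_dir_eq_sum_touching`);
* `lintegral_mul_prod_gaussWeight_eq` — `∫⁻ g(t) Π_i gaussWeight_{Q_D}(t i) dt = Z_D³ · ∫⁻ g d(gauss3 H)` (`boxDirichlet = Z⁻¹ e^{−½tᵀQ_Dt}dt`,
  `boxDirichlet_eq_withDensity`, and `GaussianToolkit.pi_withDensity`).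
No sorry; no new definition; standard axioms.  NOT a claim about the mass gap.
-/

set_option autoImplicit false
set_option synthInstance.maxSize 4096

noncomputable section

open MeasureTheory Finset
open scoped ENNReal
open Literature.Probability.LatticeModels (Site)
open Literature.MathematicalPhysics.QuantumLattice
open Literature.MathematicalPhysics.QuantumFieldTheory
open Literature.MathematicalPhysics.QuantumFieldTheory.LatticeMaxwell
open Literature.MathematicalPhysics.QuantumFieldTheory.AxialGauge
open Literature.MathematicalPhysics.QuantumFieldTheory.GaussianToolkit

namespace Summit.QuantumFields.YangMills.Theorems.WeakCouplingRates

variable {H : ℕ}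

/-! ## The change of variables `w = unscaleT β H t` -/

/-- **Change of variables with a constant Jacobian**: for `β > 0` there is `a ∈ (0, ∞)` such that
`∫⁻ F(w) dw = a · ∫⁻ F(unscaleT β H t) dt` for every measurable `F : (ColdFreeIdx H → ℝ³) → [0,∞]`. -/
theorem exists_lintegral_eq_mul_lintegral_unscaleT {β : ℝ} (hβ : 0 < β) :
    ∃ a : ℝ≥0∞, a ≠ 0 ∧ a ≠ ∞ ∧ ∀ F : (ColdFreeIdx H → (Fin 3 → ℝ)) → ℝ≥0∞, Measurable F →
      ∫⁻ w, F w ∂(volume : Measure (ColdFreeIdx H → (Fin 3 → ℝ))) =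
        a * ∫⁻ t, F (unscaleT H β t) ∂(volume : Measure (TSpace H)) := by
  set e := scaleEquiv H hβ with he
  set μ' : Measure (TSpace H) := (volume : Measure (ColdFreeIdx H → (Fin 3 → ℝ))).map e with hμ'
  haveI : μ'.IsAddHaarMeasure := by rw [hμ']; infer_instance
  have hprop : μ' = Measure.addHaarScalarFactor μ' (volume : Measure (TSpace H)) • (volume : Measure (TSpace H)) :=
    Measure.isAddLeftInvariant_eq_smul μ' volume
  have hpos : 0 < Measure.addHaarScalarFactor μ' (volume : Measure (TSpace H)) :=
    Measure.addHaarScalarFactor_pos_of_isAddHaarMeasure μ' volume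
  refine ⟨Measure.addHaarScalarFactor μ' (volume : Measure (TSpace H)), by exact_mod_cast hpos.ne', ENNReal.coe_ne_top, fun F hF => ?_⟩
  have hme : Measurable e := e.continuous.measurable
  calc ∫⁻ w, F w ∂(volume : Measure (ColdFreeIdx H → (Fin 3 → ℝ)))
      = ∫⁻ w, (F ∘ unscaleT H β) (e w) ∂(volume : Measure (ColdFreeIdx H → (Fin 3 → ℝ))) := by
        refine lintegral_congr fun w => ?_
        simp only [Function.comp_apply, he, scaleEquiv_apply, unscaleT_scaleT hβ]
    _ = ∫⁻ t, (F ∘ unscaleT H β) t ∂μ' := by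
        rw [hμ', lintegral_map (hF.comp (measurable_unscaleT β)) hme]
    _ = _ := by
        conv_lhs => rw [hprop]
        rw [lintegral_smul_measure]
        rfl

/-! ## The density identity -/

/-- The boundary Wilson action of the cold box is the sum of the plaquette costs over the plaquettes touching it. -/
theorem wilsonBoundaryAction_eq_sum_plaqCostAt (U : LGConfig 4 (Matrix.specialUnitaryGroup (Fin 2) ℂ)) :
    wilsonBoundaryAction (fundamentalRep (Fin 2)) (boxEdges 4 (2 * H + 1)) U =
      ∑ q ∈ plaquettesTouching (boxEdges 4 (2 * H + 1)), plaqCostAt (fundamentalRep (Fin 2)) q.1 q.2.1.1 q.2.1.2 U := by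
  simp [wilsonBoundaryAction, plaqCostAt]

/-- Half the sum of the three Dirichlet forms is the sum of the quadratic surrogates over the plaquettes touching the box. -/
theorem sum_formM_div_two_eq_sum_qObs (t : TSpace H) :
    ∑ i, formM (fun e => e ∉ dirFreeEdges H) dirCorner (2 * H + 3) 0 (WithLp.ofLp (t i)) / 2 =
      ∑ q ∈ plaquettesTouching (boxEdges 4 (2 * H + 1)), qObs H (q.1, q.2.1.1, q.2.1.2) t := by
  simp only [formM_dir_eq_sum_touching, qObs, ← dirCirc_apply, Finset.sum_div, Finset.mul_sum]
  rw [Finset.sum_comm]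
  refine Finset.sum_congr rfl fun q _ => Finset.sum_congr rfl fun i _ => ?_
  ring

/-- The product of the three one-colour Gaussian weights is `exp(−Σ_{p touching Λ} qObs p t)`. -/
theorem prod_gaussWeight_eq (t : TSpace H) :
    ∏ i, gaussWeight (Qmat (fun e => e ∉ dirFreeEdges H) dirCorner (2 * H + 3)) (t i) =
      ENNReal.ofReal (Real.exp (-(∑ q ∈ plaquettesTouching (boxEdges 4 (2 * H + 1)), qObs H (q.1, q.2.1.1, q.2.1.2) t))) := by
  rw [Finset.prod_congr rfl fun i _ => gaussWeight_dirQmat (t i),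
    ← ENNReal.ofReal_prod_of_nonneg (fun i _ => (Real.exp_pos _).le), ← Real.exp_sum]
  congr 2
  rw [← sum_formM_div_two_eq_sum_qObs, ← Finset.sum_neg_distrib]
  refine Finset.sum_congr rfl fun i _ => ?_
  ring

/-- The real form of the density identity. -/
theorem boltzmann_mul_gnomonicDensity_eq_real (β : ℝ) (t : TSpace H) :
    Real.exp (-β * wilsonBoundaryAction (fundamentalRep (Fin 2)) (boxEdges 4 (2 * H + 1)) (cfgT H β t)) *
        ∏ e : ColdFreeIdx H, (1 / (2 * Real.pi ^ 2) * ((1 + ∑ k, (unscaleT H β t e k) ^ 2)⁻¹) ^ 2) =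
      (1 / (2 * Real.pi ^ 2)) ^ Fintype.card (ColdFreeIdx H) *
        (Real.exp (-(∑ q ∈ plaquettesTouching (boxEdges 4 (2 * H + 1)), qObs H (q.1, q.2.1.1, q.2.1.2) t)) *
          Real.exp (tiltW H β t)) := by
  have hJ : Real.exp (∑ e : ColdFreeIdx H, Real.log (((1 + ∑ k, (unscaleT H β t e k) ^ 2)⁻¹) ^ 2)) =
      ∏ e : ColdFreeIdx H, ((1 + ∑ k, (unscaleT H β t e k) ^ 2)⁻¹) ^ 2 := by
    rw [Real.exp_sum]
    exact Finset.prod_congr rfl fun e _ => Real.exp_log (by positivity)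
  have hexp : Real.exp (-(∑ q ∈ plaquettesTouching (boxEdges 4 (2 * H + 1)), qObs H (q.1, q.2.1.1, q.2.1.2) t)) *
      Real.exp (∑ q ∈ plaquettesTouching (boxEdges 4 (2 * H + 1)),
        (qObs H (q.1, q.2.1.1, q.2.1.2) t - β * plaqCostAt (fundamentalRep (Fin 2)) q.1 q.2.1.1 q.2.1.2 (cfgT H β t))) =
      Real.exp (-β * ∑ q ∈ plaquettesTouching (boxEdges 4 (2 * H + 1)),
        plaqCostAt (fundamentalRep (Fin 2)) q.1 q.2.1.1 q.2.1.2 (cfgT H β t)) := by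
    rw [← Real.exp_add]
    congr 1
    rw [neg_mul, Finset.mul_sum, Finset.sum_sub_distrib]
    ring
  rw [wilsonBoundaryAction_eq_sum_plaqCostAt, Finset.prod_mul_distrib, Finset.prod_const, Finset.card_univ, tiltW,
    Real.exp_add, hJ]
  linear_combination (-((1 / (2 * Real.pi ^ 2)) ^ Fintype.card (ColdFreeIdx H) *
    ∏ e : ColdFreeIdx H, ((1 + ∑ k, (unscaleT H β t e k) ^ 2)⁻¹) ^ 2)) * hexp

/-- **The density identity**: `e^{−βS_Λ(cfgT t)} · Π_e gnomonicDensity(w_e) = (2π²)^{−n} · Π_i gaussWeight_{Q_D}(t i) · e^{tiltW β t}`. -/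
theorem boltzmann_mul_gnomonicDensity_eq (β : ℝ) (t : TSpace H) :
    ENNReal.ofReal (Real.exp (-β * wilsonBoundaryAction (fundamentalRep (Fin 2)) (boxEdges 4 (2 * H + 1)) (cfgT H β t))) *
        ∏ e : ColdFreeIdx H, gnomonicDensity (unscaleT H β t e) =
      ENNReal.ofReal ((1 / (2 * Real.pi ^ 2)) ^ Fintype.card (ColdFreeIdx H)) *
        (∏ i, gaussWeight (Qmat (fun e => e ∉ dirFreeEdges H) dirCorner (2 * H + 3)) (t i)) *
          ENNReal.ofReal (Real.exp (tiltW H β t)) := by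
  have hdens : ∀ e : ColdFreeIdx H, gnomonicDensity (unscaleT H β t e) =
      ENNReal.ofReal (1 / (2 * Real.pi ^ 2) * ((1 + ∑ k, (unscaleT H β t e k) ^ 2)⁻¹) ^ 2) := fun e => by
    rw [gnomonicDensity, ← ENNReal.ofReal_mul (by positivity)]
  simp only [hdens]
  rw [← ENNReal.ofReal_prod_of_nonneg (fun e _ => by positivity), ← ENNReal.ofReal_mul (Real.exp_pos _).le,
    boltzmann_mul_gnomonicDensity_eq_real, prod_gaussWeight_eq, ← ENNReal.ofReal_mul (by positivity),
    ← ENNReal.ofReal_mul (by positivity), mul_assoc]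

/-! ## Gaussian-weighted integrals are `Z³ ·` expectations under `gauss3` -/

/-- `boxDirichlet H` as Lebesgue measure with density `Z⁻¹ · gaussWeight`. -/
theorem boxDirichlet_eq_withDensity_smul (H : ℕ) :
    boxDirichlet H = (volume : Measure (EuclideanSpace ℝ (DirFree H))).withDensity
      ((gaussZ (Qmat (fun e => e ∉ dirFreeEdges H) dirCorner (2 * H + 3)))⁻¹ •
        gaussWeight (Qmat (fun e => e ∉ dirFreeEdges H) dirCorner (2 * H + 3))) := by
  obtain ⟨hτ, hZ0, hZtop⟩ := boxDirichlet_eq_withDensity H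
  rw [withDensity_smul _ (measurable_gaussWeight _), ← hτ]

/-- **Gaussian-weighted Lebesgue integrals on `TSpace` are `Z³ ·` expectations under `gauss3 H`**: for measurable `g ≥ 0`,
`∫⁻ g(t) · Π_i gaussWeight_{Q_D}(t i) dt = Z_D³ · ∫⁻ g d(gauss3 H)`. -/
theorem lintegral_mul_prod_gaussWeight_eq (g : TSpace H → ℝ≥0∞) (hg : Measurable g) :
    ∫⁻ t, g t * ∏ i, gaussWeight (Qmat (fun e => e ∉ dirFreeEdges H) dirCorner (2 * H + 3)) (t i)
        ∂(volume : Measure (TSpace H)) =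
      gaussZ (Qmat (fun e => e ∉ dirFreeEdges H) dirCorner (2 * H + 3)) ^ 3 * ∫⁻ t, g t ∂(gauss3 H) := by
  obtain ⟨-, hZ0, hZtop⟩ := boxDirichlet_eq_withDensity H
  set Q := Qmat (fun e => e ∉ dirFreeEdges H) dirCorner (2 * H + 3) with hQ
  set Z := gaussZ Q with hZ
  set f : EuclideanSpace ℝ (DirFree H) → ℝ≥0∞ := Z⁻¹ • gaussWeight Q with hf
  have hfm : Measurable f := (measurable_gaussWeight Q).const_smul _
  haveI : SigmaFinite ((volume : Measure (EuclideanSpace ℝ (DirFree H))).withDensity f) := by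
    rw [hf, ← boxDirichlet_eq_withDensity_smul]; infer_instance
  have hpi : gauss3 H = (volume : Measure (TSpace H)).withDensity fun t => ∏ i, f (t i) := by
    rw [gauss3]
    simp_rw [boxDirichlet_eq_withDensity_smul, ← hQ, ← hZ]
    rw [pi_withDensity _ _ (fun _ => hfm), volume_pi]
  have hprod : ∀ t : TSpace H, ∏ i, f (t i) = (Z⁻¹) ^ 3 * ∏ i, gaussWeight Q (t i) := fun t => by
    simp only [hf, Pi.smul_apply, smul_eq_mul, Finset.prod_mul_distrib, Finset.prod_const, Finset.card_univ,
      Fintype.card_fin]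
  have hm : Measurable (fun t : TSpace H => ∏ i, f (t i)) :=
    Finset.measurable_prod _ fun i _ => hfm.comp (measurable_pi_apply i)
  rw [hpi, lintegral_withDensity_eq_lintegral_mul _ hm hg]
  have hmeas : Measurable fun t : TSpace H => g t * ∏ i, gaussWeight Q (t i) :=
    hg.mul (Finset.measurable_prod _ fun i _ => (measurable_gaussWeight Q).comp (measurable_pi_apply i))
  have hZ3 : Z ^ 3 * (Z⁻¹) ^ 3 = 1 := by
    rw [← mul_pow, ENNReal.mul_inv_cancel hZ0 hZtop, one_pow]
  calc ∫⁻ t, g t * ∏ i, gaussWeight Q (t i) ∂(volume : Measure (TSpace H))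
      = ∫⁻ t, Z ^ 3 * ((Z⁻¹) ^ 3 * (g t * ∏ i, gaussWeight Q (t i))) ∂(volume : Measure (TSpace H)) :=
        lintegral_congr fun t => by rw [← mul_assoc, hZ3, one_mul]
    _ = Z ^ 3 * ∫⁻ t, (Z⁻¹) ^ 3 * (g t * ∏ i, gaussWeight Q (t i)) ∂(volume : Measure (TSpace H)) :=
        lintegral_const_mul _ (measurable_const.mul hmeas)
    _ = Z ^ 3 * ∫⁻ t, ((fun t : TSpace H => ∏ i, f (t i)) * g) t ∂(volume : Measure (TSpace H)) := by
        congr 1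
        exact lintegral_congr fun t => by simp only [Pi.mul_apply, hprod]; ring

end Summit.QuantumFields.YangMills.Theorems.WeakCouplingRates

end
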